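/-
Copyright: cell `pub-ymgap` (HUMAN RULING D-0062), Track A of `YM-PLAN.md`, DAG node N20 (= NE7b); R134 acceleration seat
`pub-ymgap-dag-n20-c` (strategy s1, generation 22), module 64.  Released under the licence of the surrounding project.
-/
import Summits.QuantumFields.YangMills.Theorems.BalabanUVNodesN20LCSAllLevelsCrude
import HarnessLib

/-!
# YM-DAG node N20 (= NE7b), row s1, module 64: «GAINFUL AT FIXED DEPTH» AS A KERNEL THEOREM — the all-levels letter-free bound of module 62 carries
# ONE PEIERLS FACTOR `θ` PER SKELETON CUBE AT EVERY PINNED LEVEL of a finite set `J`, for couplings below level-dependent thresholds `γ_j(θ)`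

Track A of `YM-PLAN.md` (cell `pub-ymgap`, HUMAN RULING D-0062), node **N20** = spine estimate NE7b (`T4WeightBudget.RelWeightBound`, NOT
PRINTED, NOT PROVED).  Seat `pub-ymgap-dag-n20-c` (R134, s1), generation 22, module 64.  Kernel theorems only: 0 `def`, 0 `sorry`, standard
axioms; COUNT-NEUTRAL.  Composition BY NAME of module 62 (`…N20LCSAllLevelsCrude.sum_admS_integral_le_rec_allLevels_crude`: dag-n20-d's by-value rates `τ`, `v`
∘ this seat's `B_j`; no letter of Bałaban's kind) and module 52 §2's `RkOfRecord_le_mul_pow`.  Nothing is re-declared.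

WHAT THIS FILE PROVES.
* §1 ★★ `rate_le_of_le_gstar` — module 61 §1 at a general level shift `a` (`sideχ_a = L^{a+2}M₂R_{a+1}`, `B_a = √(N·n⋆_a)·L^{2(a+1)}`) and general rate
  constants `τ > 0`, `w ≥ 0`: with `Q_a = d²(9L^{a+3}M₂)^d·L^{4(a+1)}`, `κ = τA₀²∕(2N′²Q_a)`, `t₀ = max 1 ((log Q_a + w + log θ⁻¹ + rd)∕κ)`, `γ = e^{−t₀∕2}`:
  `0 < g₀ ≤ g₁ ≤ γ` ⇒ `m(g₁)·(e^{w}·exp(−τ·g₀⁻²·((g₁p₀(g₁))∕B_a(g₁))²∕(2N′))) ≤ θ` (numerics letter `r·d + 2 ≤ 2p₀`).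
* §2 ★★★ `sum_admS_integral_le_rec_allLevels_gain` — for module 36's rates there are thresholds `γ j θ > 0` such that, for every `θ ∈ (0,1]`, every finite `J`
  with `g₀ ≤ g (j+1) ≤ γ j θ` (`j ∈ J`) and the geometric letters, EVERY pinned family `D` has a `39^d` skeleton `D′` with
  `Σ_h ∫ eterm ρ₀ K′ h ≤ θ^{Σ_{j ∈ J, j < K′} #D′ j} · ∫ρ₀` — ONE PEIERLS FACTOR `θ` PER SKELETON CUBE AT EVERY PINNED LEVEL, NO letter of Bałaban's kind.

HONEST SCOPE.  `γ j θ` DECREASES with the level `j` (through `Q_j ~ L^{(d+4)j}` and dag-n20-d's `τ (j+1)`, `v (j+1)`): this is «gainful at FIXED DEPTH» made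
precise — NOT a level-uniform rate, NOT NE7b (whose `Σ_K W_K < ∞` needs the uniform rate: (W♮) + [Balaban1985Variational] Thm 1 (8)); the letter
`r·d + 2 ≤ 2p₀` fails at def-R's displayed defaults (module 61 §3, CAUTION-R‴).  NE7b NOT PRINTED ∕ NOT PROVED; (α)-instance 0∕1; N20 NOT discharged; typed
28∕28, count untouched; one finite four-torus at fixed `ε` — NOT ℝ⁴, NOT infinite volume, NOT OS, NOT a mass gap, NOT Clay.

References (LOCATORS): T. Bałaban, CMP 119 (1988) 243–285 [Balaban1988Convergent] ((2.4)–(2.5) p.255, (3.2) p.265, (3.26)–(3.30) pp.270–271); CMP 122 (1989)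
175–202 [Balaban1989LargeFieldI] ((0.3)–(0.5) pp.176–177).
-/

set_option autoImplicit false

noncomputable section

open scoped BigOperators

namespace Summit.QuantumFields.YangMills.BalabanUVNodes.N20LCSAllLevelsGain

open MeasureTheory
open Literature.MathematicalPhysics.QuantumFieldTheory.Balaban1983to89
open Literature.MathematicalPhysics.QuantumFieldTheory.Balaban1983to89.T4Continuum
open Literature.MathematicalPhysics.QuantumFieldTheory.Balaban1983to89.Node00
open B15DeterminingSets B14.Eq213DetSet B14.Eq213MaximalDomains B15Eq112TorusCover B14DomainGeom
open Literature.MathematicalPhysics.QuantumFieldTheory.Balaban1983to89.B14SeparationOfRecord (one_le_RkOfRecord)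
open Summit.QuantumFields.BalabanUV.T4Continuum.B16HistoryIndexedRepr (GoodClass)
open Summit.QuantumFields.BalabanUV.T4Continuum.B16HistoryReprChain
open Summit.QuantumFields.BalabanUV.T4Continuum.NE7b.PrefixExtraction (admS)
open Summit.QuantumFields.YangMills.BalabanUVNodes.N20LCSLabelTower
open Summit.QuantumFields.YangMills.BalabanUVNodes.N20LCSSmallCouplingRegime (RkOfRecord_le_mul_pow)
open Summit.QuantumFields.YangMills.BalabanUVNodes.N20LCSAllLevelsCrude (sum_admS_integral_le_rec_allLevels_crude)

/-! ## §1  The level-`a` rate at `B_a(g₁)` is below any `θ ∈ (0,1]` below an explicit `γ_a(θ)` -/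

section Rate

/-- ★★ **THE LEVEL-`a` RATE IS BELOW `θ` BELOW `γ_a(θ)`** (module 61 §1 at the χ_{a+1}-cubes, `sideχ_a = L^{a+2}M₂R`, `B_a = √(N′·n⋆_a)·L^{2(a+1)}`, rate constants
`τ > 0`, `w ≥ 0`): `Q_a = d²(9L^{a+3}M₂)^d·L^{4(a+1)}`, `κ = τA₀²∕(2N′²Q_a)`, `t₀ = max 1 ((log Q_a + w + log θ⁻¹ + rd)∕κ)`; for `0 < g₀ ≤ g₁ ≤ e^{−t₀∕2}`:
`m(g₁)·(e^{w}·e^{−τ·g₀⁻²·((g₁p₀(g₁))∕(√(N′·n⋆_a(g₁))·L^{2(a+1)}))²∕(2N′)}) ≤ θ`.  Letter: `r·d + 2 ≤ 2p₀`. [cite: Balaban1988Convergent, (2.4)–(2.5) p.255, (2.17) p.257] -/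
theorem rate_le_of_le_gstar {N' τ w A₀ θ : ℝ} {p₀ r d L M₂ : ℕ} (a : ℕ) (hN : 1 ≤ N') (hτ : 0 < τ) (hw : 0 ≤ w) (hA : 0 < A₀)
    (hθ : 0 < θ) (hθ1 : θ ≤ 1) (hp : r * d + 2 ≤ 2 * p₀) (hd : 1 ≤ d) (hL : 2 ≤ L) (hM₂ : 1 ≤ M₂)
    {g₀ g₁ : ℝ} (hg0 : 0 < g₀) (hg01 : g₀ ≤ g₁)
    (hg : g₁ ≤ Real.exp (-(max 1 ((Real.log ((d ^ 2 * (9 * L ^ (a + 3) * M₂) ^ d * L ^ (4 * (a + 1)) : ℕ) : ℝ) + w + Real.log θ⁻¹ +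
        ((r * d : ℕ) : ℝ)) /
        (τ * A₀ ^ 2 / (2 * N' * N' * ((d ^ 2 * (9 * L ^ (a + 3) * M₂) ^ d * L ^ (4 * (a + 1)) : ℕ) : ℝ))))) / 2)) :
    ((d ^ 2 * (9 * (L * M₂ * RkOfRecord L r g₁)) ^ d : ℕ) : ℝ) *
        (Real.exp w * Real.exp (-(τ * g₀⁻¹ ^ 2 * (((g₁ * p0Profile A₀ p₀ g₁) /
          (Real.sqrt (N' * ((d ^ 2 * (9 * (L ^ (a + 2) * M₂ * RkOfRecord L r g₁)) ^ d : ℕ) : ℝ)) * (L : ℝ) ^ (2 * (a + 1)))) ^ 2 /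
            (2 * N'))))) ≤ θ := by
  -- abbreviations
  set Q : ℝ := ((d ^ 2 * (9 * L ^ (a + 3) * M₂) ^ d * L ^ (4 * (a + 1)) : ℕ) : ℝ) with hQ
  set κ : ℝ := τ * A₀ ^ 2 / (2 * N' * N' * Q) with hκ
  set S : ℝ := Real.log Q + w + Real.log θ⁻¹ with hS
  set t₀ : ℝ := max 1 ((S + ((r * d : ℕ) : ℝ)) / κ) with ht₀
  set t : ℝ := Real.log (g₁ ^ 2)⁻¹ with ht
  set m : ℝ := ((d ^ 2 * (9 * (L * M₂ * RkOfRecord L r g₁)) ^ d : ℕ) : ℝ) with hm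
  set n : ℝ := ((d ^ 2 * (9 * (L ^ (a + 2) * M₂ * RkOfRecord L r g₁)) ^ d : ℕ) : ℝ) with hn
  have hg1 : 0 < g₁ := lt_of_lt_of_le hg0 hg01
  have hL1 : (1 : ℝ) ≤ L := by exact_mod_cast (by omega : 1 ≤ L)
  have hL0 : (0 : ℝ) < L := by linarith
  have hLpow : (1 : ℝ) ≤ (L : ℝ) ^ (4 * (a + 1)) := one_le_pow₀ hL1
  have hQ1 : (1 : ℝ) ≤ Q := by
    have : 1 ≤ d ^ 2 * (9 * L ^ (a + 3) * M₂) ^ d * L ^ (4 * (a + 1)) :=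
      Nat.mul_pos (Nat.mul_pos (pow_pos (by omega) 2) (pow_pos (Nat.mul_pos (Nat.mul_pos (by norm_num) (pow_pos (by omega) _)) (by omega)) _))
        (pow_pos (by omega) _)
    rw [hQ]; exact_mod_cast this
  have hQ0 : 0 < Q := lt_of_lt_of_le one_pos hQ1
  have hN0 : 0 < N' := lt_of_lt_of_le one_pos hN
  have hκ0 : 0 < κ := by rw [hκ]; positivity
  have hS0 : 0 ≤ S := by
    have h1 : 0 ≤ Real.log Q := Real.log_nonneg hQ1
    have h2 : 0 ≤ Real.log θ⁻¹ := Real.log_nonneg (one_le_inv_iff₀.2 ⟨hθ, hθ1⟩)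
    rw [hS]; positivity
  have ht₀1 : 1 ≤ t₀ := le_max_left _ _
  have hSκ : S + ((r * d : ℕ) : ℝ) ≤ κ * t₀ := by
    have h : (S + ((r * d : ℕ) : ℝ)) / κ ≤ t₀ := le_max_right _ _
    calc S + ((r * d : ℕ) : ℝ) ≤ t₀ * κ := (div_le_iff₀ hκ0).1 h
      _ = κ * t₀ := mul_comm _ _
  -- `t ≥ t₀ ≥ 1`
  have htt₀ : t₀ ≤ t := by
    have h1 : g₁ ^ 2 ≤ Real.exp (-t₀) := by
      have h2 : g₁ ^ 2 ≤ Real.exp (-t₀ / 2) ^ 2 := pow_le_pow_left₀ hg1.le hg 2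
      rwa [← Real.exp_nat_mul, show ((2 : ℕ) : ℝ) * (-t₀ / 2) = -t₀ by push_cast; ring] at h2
    have h3 : Real.exp t₀ ≤ (g₁ ^ 2)⁻¹ := by
      rw [le_inv_comm₀ (Real.exp_pos _) (by positivity), ← Real.exp_neg]
      exact h1
    rw [ht]
    exact (Real.le_log_iff_exp_le (by positivity)).2 h3
  have ht1 : 1 ≤ t := ht₀1.trans htt₀
  have ht0 : 0 < t := lt_of_lt_of_le one_pos ht1
  -- `R(g₁) ≤ L·t^r`, `m ≤ Q t^{rd}`, `n·L^{4(a+1)} ≤ Q t^{rd}`, `1 ≤ m`, `1 ≤ n`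
  have htr : 1 ≤ t ^ r := one_le_pow₀ ht1
  have hR : (RkOfRecord L r g₁ : ℝ) ≤ L * t ^ r := RkOfRecord_le_mul_pow hL r htr
  have hR1 : 1 ≤ RkOfRecord L r g₁ := one_le_RkOfRecord (by omega) _ _
  have hLa : (L : ℝ) ^ 2 ≤ (L : ℝ) ^ (a + 3) := pow_le_pow_right₀ hL1 (by omega)
  have hm' : m = (d : ℝ) ^ 2 * (9 * ((L : ℝ) * M₂ * RkOfRecord L r g₁)) ^ d := by rw [hm]; push_cast; ring
  have hn' : n = (d : ℝ) ^ 2 * (9 * ((L : ℝ) ^ (a + 2) * M₂ * RkOfRecord L r g₁)) ^ d := by rw [hn]; push_cast; ring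
  have hQ' : Q = (d : ℝ) ^ 2 * (9 * (L : ℝ) ^ (a + 3) * M₂) ^ d * (L : ℝ) ^ (4 * (a + 1)) := by rw [hQ]; push_cast; ring
  have htrd' : t ^ (r * d) = (t ^ r) ^ d := pow_mul t r d
  have hmQ : m ≤ Q * t ^ (r * d) := by
    rw [hm', hQ', htrd']
    have h1 : (9 : ℝ) * ((L : ℝ) * M₂ * RkOfRecord L r g₁) ≤ 9 * (L : ℝ) ^ (a + 3) * M₂ * t ^ r :=
      calc (9 : ℝ) * ((L : ℝ) * M₂ * RkOfRecord L r g₁) ≤ 9 * ((L : ℝ) * M₂ * (L * t ^ r)) :=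
            mul_le_mul_of_nonneg_left (mul_le_mul_of_nonneg_left hR (by positivity)) (by norm_num)
        _ = 9 * (L : ℝ) ^ 2 * M₂ * t ^ r := by ring
        _ ≤ 9 * (L : ℝ) ^ (a + 3) * M₂ * t ^ r := by
            have : 0 ≤ (9 : ℝ) * M₂ * t ^ r := by positivity
            nlinarith
    have h2 : ((9 : ℝ) * ((L : ℝ) * M₂ * RkOfRecord L r g₁)) ^ d ≤ (9 * (L : ℝ) ^ (a + 3) * M₂ * t ^ r) ^ d :=
      pow_le_pow_left₀ (by positivity) h1 d
    calc (d : ℝ) ^ 2 * ((9 : ℝ) * ((L : ℝ) * M₂ * RkOfRecord L r g₁)) ^ d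
        ≤ (d : ℝ) ^ 2 * (9 * (L : ℝ) ^ (a + 3) * M₂ * t ^ r) ^ d := mul_le_mul_of_nonneg_left h2 (by positivity)
      _ = (d : ℝ) ^ 2 * (9 * (L : ℝ) ^ (a + 3) * M₂) ^ d * 1 * (t ^ r) ^ d := by rw [mul_pow]; ring
      _ ≤ (d : ℝ) ^ 2 * (9 * (L : ℝ) ^ (a + 3) * M₂) ^ d * (L : ℝ) ^ (4 * (a + 1)) * (t ^ r) ^ d := by
          have h0 : 0 ≤ (d : ℝ) ^ 2 * (9 * (L : ℝ) ^ (a + 3) * M₂) ^ d := by positivity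
          have h0' : 0 ≤ (t ^ r) ^ d := by positivity
          exact mul_le_mul_of_nonneg_right (mul_le_mul_of_nonneg_left hLpow h0) h0'
  have hnQ : n * (L : ℝ) ^ (4 * (a + 1)) ≤ Q * t ^ (r * d) := by
    rw [hn', hQ', htrd']
    have h1 : (9 : ℝ) * ((L : ℝ) ^ (a + 2) * M₂ * RkOfRecord L r g₁) ≤ 9 * (L : ℝ) ^ (a + 3) * M₂ * t ^ r :=
      calc (9 : ℝ) * ((L : ℝ) ^ (a + 2) * M₂ * RkOfRecord L r g₁) ≤ 9 * ((L : ℝ) ^ (a + 2) * M₂ * (L * t ^ r)) :=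
            mul_le_mul_of_nonneg_left (mul_le_mul_of_nonneg_left hR (by positivity)) (by norm_num)
        _ = 9 * (L : ℝ) ^ (a + 3) * M₂ * t ^ r := by ring
    have h2 : ((9 : ℝ) * ((L : ℝ) ^ (a + 2) * M₂ * RkOfRecord L r g₁)) ^ d ≤ (9 * (L : ℝ) ^ (a + 3) * M₂ * t ^ r) ^ d :=
      pow_le_pow_left₀ (by positivity) h1 d
    calc (d : ℝ) ^ 2 * ((9 : ℝ) * ((L : ℝ) ^ (a + 2) * M₂ * RkOfRecord L r g₁)) ^ d * (L : ℝ) ^ (4 * (a + 1))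
        ≤ (d : ℝ) ^ 2 * (9 * (L : ℝ) ^ (a + 3) * M₂ * t ^ r) ^ d * (L : ℝ) ^ (4 * (a + 1)) :=
          mul_le_mul_of_nonneg_right (mul_le_mul_of_nonneg_left h2 (by positivity)) (by positivity)
      _ = (d : ℝ) ^ 2 * (9 * (L : ℝ) ^ (a + 3) * M₂) ^ d * (L : ℝ) ^ (4 * (a + 1)) * (t ^ r) ^ d := by rw [mul_pow]; ring
  have hm1 : 1 ≤ m := by
    have : 1 ≤ d ^ 2 * (9 * (L * M₂ * RkOfRecord L r g₁)) ^ d :=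
      Nat.mul_pos (pow_pos (by omega) 2) (pow_pos (Nat.mul_pos (by norm_num) (Nat.mul_pos (Nat.mul_pos (by omega) (by omega)) hR1)) _)
    rw [hm]; exact_mod_cast this
  have hn1 : 1 ≤ n := by
    have : 1 ≤ d ^ 2 * (9 * (L ^ (a + 2) * M₂ * RkOfRecord L r g₁)) ^ d :=
      Nat.mul_pos (pow_pos (by omega) 2) (pow_pos (Nat.mul_pos (by norm_num) (Nat.mul_pos (Nat.mul_pos (pow_pos (by omega) _) (by omega)) hR1)) _)
    rw [hn]; exact_mod_cast this
  have hn0 : 0 < n := lt_of_lt_of_le one_pos hn1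
  have htrd : 0 < t ^ (r * d) := pow_pos ht0 _
  -- the exponent: `τ g₀⁻² (ε/B)²/(2N') ≥ κ t^{2p₀ − rd} ≥ κ t²`
  have hB2 : (Real.sqrt (N' * n) * (L : ℝ) ^ (2 * (a + 1))) ^ 2 = N' * (n * (L : ℝ) ^ (4 * (a + 1))) := by
    rw [mul_pow, Real.sq_sqrt (by positivity), ← pow_mul, show 2 * (a + 1) * 2 = 4 * (a + 1) by ring]; ring
  have hprof : (g₁ * p0Profile A₀ p₀ g₁) ^ 2 = g₁ ^ 2 * (A₀ ^ 2 * t ^ (2 * p₀)) := by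
    unfold p0Profile; rw [← ht, mul_pow, mul_pow, ← pow_mul, mul_comm p₀ 2]
  obtain ⟨e, he⟩ : ∃ e : ℕ, 2 * p₀ = r * d + e ∧ 2 ≤ e := ⟨2 * p₀ - r * d, by omega, by omega⟩
  have hnL0 : 0 < n * (L : ℝ) ^ (4 * (a + 1)) := by positivity
  have hexp : κ * t ^ 2 ≤ τ * g₀⁻¹ ^ 2 * (((g₁ * p0Profile A₀ p₀ g₁) / (Real.sqrt (N' * n) * (L : ℝ) ^ (2 * (a + 1)))) ^ 2 / (2 * N')) := by
    rw [div_pow, hB2, hprof, he.1, pow_add]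
    have hg2 : 1 ≤ g₀⁻¹ ^ 2 * g₁ ^ 2 := by
      rw [inv_pow, ← div_eq_inv_mul, one_le_div (by positivity)]
      exact pow_le_pow_left₀ hg0.le hg01 2
    have hte : t ^ 2 ≤ t ^ e := pow_le_pow_right₀ ht1 he.2
    have h1 : κ * t ^ 2 ≤ κ * t ^ e := mul_le_mul_of_nonneg_left hte hκ0.le
    have h2 : κ * t ^ e = τ * (A₀ ^ 2 * t ^ e) / (2 * N' * N' * Q) := by rw [hκ]; ring
    have h3 : τ * (A₀ ^ 2 * t ^ e) / (2 * N' * N' * Q) ≤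
        τ * (A₀ ^ 2 * (t ^ (r * d) * t ^ e)) / (2 * N' * (N' * (n * (L : ℝ) ^ (4 * (a + 1))))) := by
      rw [div_le_div_iff₀ (by positivity) (by positivity)]
      have : N' * (n * (L : ℝ) ^ (4 * (a + 1))) ≤ N' * (Q * t ^ (r * d)) := mul_le_mul_of_nonneg_left hnQ hN0.le
      calc τ * (A₀ ^ 2 * t ^ e) * (2 * N' * (N' * (n * (L : ℝ) ^ (4 * (a + 1)))))
          ≤ τ * (A₀ ^ 2 * t ^ e) * (2 * N' * (N' * (Q * t ^ (r * d)))) := by gcongr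
        _ = τ * (A₀ ^ 2 * (t ^ (r * d) * t ^ e)) * (2 * N' * N' * Q) := by ring
    have h4 : τ * (A₀ ^ 2 * (t ^ (r * d) * t ^ e)) / (2 * N' * (N' * (n * (L : ℝ) ^ (4 * (a + 1))))) ≤
        τ * g₀⁻¹ ^ 2 * (g₁ ^ 2 * (A₀ ^ 2 * (t ^ (r * d) * t ^ e)) / (N' * (n * (L : ℝ) ^ (4 * (a + 1)))) / (2 * N')) := by
      rw [show τ * g₀⁻¹ ^ 2 * (g₁ ^ 2 * (A₀ ^ 2 * (t ^ (r * d) * t ^ e)) / (N' * (n * (L : ℝ) ^ (4 * (a + 1)))) / (2 * N')) =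
        (g₀⁻¹ ^ 2 * g₁ ^ 2) * (τ * (A₀ ^ 2 * (t ^ (r * d) * t ^ e)) / (2 * N' * (N' * (n * (L : ℝ) ^ (4 * (a + 1)))))) by
          field_simp]
      exact le_mul_of_one_le_left (by positivity) hg2
    linarith
  -- `log m ≤ log Q + rd·t`
  have hlogm : Real.log m ≤ Real.log Q + ((r * d : ℕ) : ℝ) * t := by
    have h1 : Real.log m ≤ Real.log (Q * t ^ (r * d)) := Real.log_le_log (lt_of_lt_of_le one_pos hm1) hmQ
    have h2 : Real.log (Q * t ^ (r * d)) = Real.log Q + ((r * d : ℕ) : ℝ) * Real.log t := by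
      rw [Real.log_mul (by positivity) (by positivity), Real.log_pow]
    have h3 : Real.log t ≤ t := (Real.log_le_sub_one_of_pos ht0).trans (by linarith)
    rw [h2] at h1
    have h5 := mul_le_mul_of_nonneg_left h3 (Nat.cast_nonneg (α := ℝ) (r * d))
    linarith
  have hkey : Real.log Q + ((r * d : ℕ) : ℝ) * t + w - κ * t ^ 2 ≤ Real.log θ := by
    have h1 : (S + ((r * d : ℕ) : ℝ)) * t ≤ κ * t ^ 2 := by
      have h11 : (S + ((r * d : ℕ) : ℝ)) * t ≤ κ * t₀ * t := mul_le_mul_of_nonneg_right hSκ ht0.le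
      have h12 : κ * t₀ * t ≤ κ * t * t := mul_le_mul_of_nonneg_right (mul_le_mul_of_nonneg_left htt₀ hκ0.le) ht0.le
      have h13 : κ * t * t = κ * t ^ 2 := by ring
      linarith only [h11, h12, h13]
    have h2 : S + ((r * d : ℕ) : ℝ) * t ≤ (S + ((r * d : ℕ) : ℝ)) * t := by
      have h21 : S * 1 ≤ S * t := mul_le_mul_of_nonneg_left ht1 hS0
      have h22 : (S + ((r * d : ℕ) : ℝ)) * t = S * t + ((r * d : ℕ) : ℝ) * t := by ring
      linarith only [h21, h22]
    have h3 : Real.log θ⁻¹ = -Real.log θ := Real.log_inv θ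
    have h4 : S = Real.log Q + w - Real.log θ := by rw [hS, h3]; ring
    linarith only [h1, h2, h4]
  have hpos : 0 < m * (Real.exp w * Real.exp (-(τ * g₀⁻¹ ^ 2 * (((g₁ * p0Profile A₀ p₀ g₁) /
      (Real.sqrt (N' * n) * (L : ℝ) ^ (2 * (a + 1)))) ^ 2 / (2 * N'))))) := by positivity
  rw [← Real.log_le_log_iff hpos hθ, Real.log_mul (by positivity) (by positivity), Real.log_mul (Real.exp_pos _).ne' (Real.exp_pos _).ne',
    Real.log_exp, Real.log_exp]
  linarith only [hkey, hlogm, hexp]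

end Rate

/-! ## §2  One Peierls factor `θ` per skeleton cube at EVERY pinned level of a finite set, below level-dependent `γ_j(θ)` -/

section Gain

variable (F : T4Family) (N : ℕ) [NeZero N] (ν : Stage7Numerics) (M : ℕ) (p : B12.RunParams) (g : ℕ → ℝ)

open Classical in
/-- ★★★ **«GAINFUL AT FIXED DEPTH», IN KERNEL**: for dag-n20-d's by-value rates (`τ`, `v` of module 36) there are thresholds `γ j θ > 0` — explicit in `τ (j+1)`,
`v (j+1)`, `N`, `d`, `L`, `M₂`, `A₀`, `p₀`, `r`, `j`, `θ` (§1 at `a = j`) — such that for every `θ ∈ (0,1]`, every finite set `J` of pinned levels with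
`0 < g₀ ≤ g (j+1) ≤ γ j θ` for `j ∈ J` (and `4N ≤ g₀⁻²`, geometric letters `j + 1 ≤ m + K`, `L^{j+1}M₁ ∣ 2L^{m+K}`, `LM₁ ≤ sideχ_j`), EVERY pinned family `D` has a
`39^d`-dense skeleton `D′` (module 51) with, for every cutoff `K′` and every label pattern `E` pinning `D` at `J` and free elsewhere,
`Σ_{h ∈ admS … K′} ∫ eterm ρ₀ K′ h dμ_{K′} ≤ θ^{Σ_{j ∈ J, j < K′} #D′ j} · ∫ρ₀ dU₀` — module 62 with every level's rate bounded by §1.  Letter `r·d + 2 ≤ 2p₀`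
(fails at def-R's defaults, module 61 §3).  NOT level-uniform: `γ j θ` shrinks with `j`. [cite: Balaban1988Convergent, (3.2) p.265, (3.26)–(3.30) pp.270–271; Balaban1989LargeFieldI, (0.3)–(0.5) pp.176–177] -/
theorem sum_admS_integral_le_rec_allLevels_gain (A₁ : ℝ) (hM₂ : 0 < ν.M₂) (hM₁ : 1 ≤ ν.M₁) (hA : 0 < ν.A₀)
    (hp : ν.r * (F.P p.K).d + 2 ≤ 2 * ν.p₀) :
    ∃ γ : ℕ → ℝ → ℝ, (∀ j θ, 0 < γ j θ) ∧ ∀ (θ : ℝ), 0 < θ → θ ≤ 1 → ∀ (g₀ E₀ : ℝ), 0 < g₀ → 4 * N ≤ g₀⁻¹ ^ 2 →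
      ∀ (J : Finset ℕ), (∀ j ∈ J, j < p.K) → (∀ j ∈ J, j + 1 ≤ (F.P p.K).m + (F.P p.K).K) →
      (∀ j ∈ J, side (F.P p.K).L ν.M₁ (j + 1) ∣ (F.P p.K).sitesPerDir 0) → (∀ j ∈ J, side (F.P p.K).L ν.M₁ 1 ≤ sideχ F ν p g j) →
      (∀ j ∈ J, g₀ ≤ g (j + 1) ∧ g (j + 1) ≤ γ j θ) →
      ∀ (D : (j : ℕ) → Finset (Iχ F ν p g j)), ∃ D' : (j : ℕ) → Finset (Iχ F ν p g j),
        (∀ j, D' j ⊆ D j ∧ (D j).card ≤ 39 ^ (F.P p.K).d * (D' j).card) ∧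
      ∀ (K' : ℕ) (E : (j : ℕ) → (Fin j → LabelPat F ν p g) → Finset (LbOfRecord F ν p g j)),
        (∀ j ∈ J, ∀ h t, t ∈ E j h → D j ⊆ t.1) → (∀ j, j ∉ J → ∀ h, E j h = Finset.univ) →
        ∑ h ∈ admS (labelTowerOfRecord F N ν M p g A₁ (zeta316OfRecord F N ν M A₁)) (labelPattern F ν p g E) K',
            ∫ x, (labelTowerOfRecord F N ν M p g A₁ (zeta316OfRecord F N ν M A₁)).eterm (rhoZeroOfRecord F N p.K g₀ E₀) K' h x
              ∂(lawOfRecord F N p.K K') ≤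
          θ ^ (∑ j ∈ J.filter (· < K'), (D' j).card) * ∫ U, rhoZeroOfRecord F N p.K g₀ E₀ U ∂(fieldMeasure (F.P p.K) 0 (SU N)) := by
  obtain ⟨τ, hτ, v, hv, h62⟩ := sum_admS_integral_le_rec_allLevels_crude F N ν M p g A₁ hM₂ hM₁
  -- the thresholds of §1 at `a = j`, `τ := τ (j+1)`, `w := v (j+1)`, `N′ := N`
  refine ⟨fun j θ => Real.exp (-(max 1 ((Real.log (((F.P p.K).d ^ 2 * (9 * (F.P p.K).L ^ (j + 3) * ν.M₂) ^ (F.P p.K).d *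
      (F.P p.K).L ^ (4 * (j + 1)) : ℕ) : ℝ) + v (j + 1) + Real.log θ⁻¹ + ((ν.r * (F.P p.K).d : ℕ) : ℝ)) /
      (τ (j + 1) * ν.A₀ ^ 2 / (2 * (Fintype.card (Fin N) : ℝ) * (Fintype.card (Fin N) : ℝ) *
        (((F.P p.K).d ^ 2 * (9 * (F.P p.K).L ^ (j + 3) * ν.M₂) ^ (F.P p.K).d * (F.P p.K).L ^ (4 * (j + 1)) : ℕ) : ℝ))))) / 2),
    fun j θ => Real.exp_pos _, ?_⟩
  intro θ hθ hθ1 g₀ E₀ hg0 hg4 J hJ hJm hdiv hsz hγ D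
  have hε : ∀ j ∈ J, 0 < epsOfRecord ν g (j + 1) := by
    intro j hj
    have hg1 : 0 < g (j + 1) := lt_of_lt_of_le hg0 (hγ j hj).1
    have h1 : g (j + 1) < 1 := by
      refine (hγ j hj).2.trans_lt ((Real.exp_lt_exp.2 ?_).trans_eq Real.exp_zero)
      exact div_neg_of_neg_of_pos (neg_neg_of_pos (lt_max_of_lt_left one_pos)) two_pos
    unfold epsOfRecord p0Profile
    have ht : 0 < Real.log ((g (j + 1)) ^ 2)⁻¹ := by
      apply Real.log_pos
      have h2 : (g (j + 1)) ^ 2 < 1 := by nlinarith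
      exact one_lt_inv_iff₀.2 ⟨by positivity, h2⟩
    positivity
  obtain ⟨D', hD', hbound⟩ := h62 g₀ E₀ hg4 J hJ hJm hdiv hsz hε D
  refine ⟨D', hD', ?_⟩
  intro K' E hE hfree
  refine (hbound K' E hE hfree).trans (mul_le_mul_of_nonneg_right ?_ (integral_nonneg fun U => (rhoZeroOfRecord_pos F N p.K g₀ E₀ U).le))
  rw [← Finset.prod_pow_eq_pow_sum]
  refine Finset.prod_le_prod (fun j _ => by positivity) ?_
  intro j hj
  have hjJ : j ∈ J := (Finset.mem_filter.1 hj).1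
  refine pow_le_pow_left₀ (by positivity) ?_ _
  have hN1 : (1 : ℝ) ≤ (Fintype.card (Fin N) : ℝ) := by
    rw [Fintype.card_fin]; exact_mod_cast Nat.one_le_iff_ne_zero.2 (NeZero.ne N)
  have hcard : (Fintype.card (Fin N) : ℝ) = N := by rw [Fintype.card_fin]
  have hside : sideχ F ν p g j = (F.P p.K).L ^ (j + 2) * ν.M₂ * RkOfRecord (F.P p.K).L ν.r (g (j + 1)) := by
    unfold sideχ cubeSide; ring
  have key := rate_le_of_le_gstar (N' := (Fintype.card (Fin N) : ℝ)) (τ := τ (j + 1)) (w := v (j + 1)) (A₀ := ν.A₀) (θ := θ)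
    (p₀ := ν.p₀) (r := ν.r) (d := (F.P p.K).d) (L := (F.P p.K).L) (M₂ := ν.M₂) j hN1 (hτ (j + 1)) (hv (j + 1)) hA hθ hθ1 hp
    (F.P p.K).hd (F.P p.K).hL.2 hM₂ (g₀ := g₀) (g₁ := g (j + 1)) hg0 (hγ j hjJ).1 (hγ j hjJ).2
  have hside' : (((F.P p.K).d ^ 2 * (9 * sideχ F ν p g j) ^ (F.P p.K).d : ℕ) : ℝ) =
      (((F.P p.K).d ^ 2 * (9 * ((F.P p.K).L ^ (j + 2) * ν.M₂ * RkOfRecord (F.P p.K).L ν.r (g (j + 1)))) ^ (F.P p.K).d : ℕ) : ℝ) := by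
    rw [hside]
  have hεdef : epsOfRecord ν g (j + 1) = g (j + 1) * p0Profile ν.A₀ ν.p₀ (g (j + 1)) := rfl
  rw [hεdef, hside', ← hcard]
  convert key using 3

end Gain

end Summit.QuantumFields.YangMills.BalabanUVNodes.N20LCSAllLevelsGain

end
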